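import Summits.QuantumFields.YangMills.Theorems.AllWindowsColdBoxBoxHighLineGaussianPolyTail
import Summits.QuantumFields.YangMills.Theorems.AllWindowsColdBoxBoxHighLineCubicByName
import Summits.QuantumFields.YangMills.Theorems.AllWindowsColdBoxBoxHighLineTiltSupBoundsWilson

/-!
# The cubic Taylor POLYNOMIAL of the cubic vertex `V₃ = cubicVertex β H`: certificate, sup-distance on the small field, Gaussian size, tail
# (input of the recorded lift L4 «probabilistic cubic cut» of U5, `Cruxes/BoxWindowHighSU2213/U5-BLOCKERS.md` §2; LINE-20 U5 ⟨stmt-QuantumFields-24336⟩)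

Width seat `ym-line-sfw-p2-w5` (prover-ym-line-sfw-p2-w5-g23-0).  `cubicVertex β H a = β·Σ_{p touching the box} c_p^{odd}(a)` is odd but NOT a
polynomial; ✓7a `wilsonPlaquetteTaylor` (w2 g31) gives per plaquette a bounded triple-product form with `|c_p^{odd} − tripleForm T_p (plaqVar_p a)| ≤ C·t⁵`
(`‖plaqVar‖ ≤ t ≤ 1`).  Packaging the objects that LEAD's ✓`cubicVariance_of` builds internally, BY NAME:

* ★ `exists_cubicVertexPoly` — `∃ C ≥ 0, ∀ H ≥ 1, ∀ β > 0, ∃ F` (`= β·Σ_p tripleForm T_p (plaqVar_p ·)`) with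
  (i) the ✓`polyCert` certificate of degree `≤ 3` (✓`polyCert_tripleFormSum`),
  (ii) `|cubicVertex β H a − F a| ≤ C·β·H⁴·s⁵` on `smallField H s` (✓`abs_odd_sub_tripleForm_le`, ✓`TiltSup.sum_norm_plaqVar_le`,
       ✓`TiltSup.card_plaquettesTouching_le'`),
  (iii) `E₀[F²] ≤ C·H⁴·(1+log H)³/β` (✓`tripleBond_gaussAvg_le`, LEAD g77);
* ★★ `gaussAvg_sfInd_mul_indicator_cubicVertex_le` — the TAIL OF THE CUBIC VERTEX ON THE SMALL FIELD: for `λ > 0`, `r ≥ 1`, `0 ≤ s`,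
  `E₀[1_D · 1_{λ + C·β·H⁴·s⁵ ≤ |V₃|}] ≤ (2r−1)^{3r} · (C·H⁴(1+log H)³/β)^r / λ^{2r}` (✓`gaussAvg_sfInd_mul_indicator_le_pow_of_polyCert`, this seat) —
  the Gaussian `p`-input of w4 g29's «EventInsideFP» for the cubic cut `A = {|V₃| > λ′}` (in the U5 letters `s = β^{−1/2+κ₃}`, `λ′ = 1`:
  `β·H⁴·s⁵ = β^{4θ+5κ₃−3/2} → 0` and `(H⁴log³H/β)^r = β^{−r(1−4θ)}·polylog`).

Everything proved; tree only; no definitions; standard axioms.  HONEST LABEL: a Gaussian input for the recorded, unstaffed lift L4 of the NEXT rung U5;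
S5/T-S5.13, U5, ⟨24004⟩ ⟨24335⟩ ⟨24336⟩ remain OPEN; no crux, rung or summit is proved; **the Yang–Mills mass gap is NOT proved by this file; no summit is
proved by a line.**
-/

set_option autoImplicit false

noncomputable section

open MeasureTheory Matrix Finset
open Literature.Probability.LatticeModels (Site)
open Literature.MathematicalPhysics.QuantumLattice (ZdPlaquette plaquettesTouching)
open Literature.MathematicalPhysics.QuantumFieldTheory.AxialGauge (boxEdges)

namespace Summit.QuantumFields.YangMills.Theorems.AllWindowsColdBoxBoxHighLine

namespace EdgeChartGaussian

open LaplaceSandwich (flatten)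

/-- ★ **The cubic Taylor polynomial of the cubic vertex**: a degree-`3` certified polynomial `F` with `|V₃ − F| ≤ C·β·H⁴·s⁵` on `smallField H s`
and `E₀[F²] ≤ C·H⁴·(1+log H)³/β`. -/
theorem exists_cubicVertexPoly : ∃ C : ℝ, 0 ≤ C ∧ ∀ H : ℕ, 1 ≤ H → ∀ β : ℝ, 0 < β →
    ∃ F : (LandauFree H → E3) → ℝ,
      (∃ Q : MvPolynomial (LandauFree H × Fin 3) ℝ, Q.totalDegree ≤ 3 ∧ ∀ a, F a = MvPolynomial.eval (flatten (LandauFree H) a) Q) ∧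
      (∀ s : ℝ, 0 ≤ s → ∀ a ∈ smallField H s, |cubicVertex β H a - F a| ≤ C * β * (H : ℝ) ^ 4 * s ^ 5) ∧
      gaussAvg β H (fun a => F a ^ 2) ≤ C * (H : ℝ) ^ 4 * (1 + Real.log H) ^ 3 / β := by
  classical
  obtain ⟨C7, h7⟩ := wilsonPlaquetteTaylor
  choose Tf hTf h7f using h7
  obtain ⟨CTB, hTB⟩ := tripleBond_gaussAvg_le
  let T : ZdPlaquette 4 → Fin 4 → Fin 4 → Fin 4 → ℝ := fun p => Tf p.2.1.1 p.2.1.2 (ne_of_lt p.2.2)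
  have hT : ∀ p i j k, |T p i j k| ≤ C7 := fun p => hTf _ _ _
  have hC7 : 0 ≤ C7 := (abs_nonneg _).trans (hT (((0 : Site 4), ⟨(0, 1), by decide⟩) : ZdPlaquette 4) 0 0 0)
  refine ⟨max (4096 * 1024 * (4 + 6 * C7)) (max CTB 0 * C7 ^ 2), le_max_of_le_left (by positivity), fun H hH β hβ => ?_⟩
  have hH1 : (1 : ℝ) ≤ H := by exact_mod_cast hH
  refine ⟨fun a => β * ∑ p ∈ plaquettesTouching (boxEdges 4 (2 * H + 1)), tripleForm (T p) (plaqVar H p.1 p.2.1.1 p.2.1.2 a),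
    polyCert_tripleFormSum H β _ T hT, fun s hs a ha => ?_, ?_⟩
  · -- the quintic remainder on the small field
    have hV : cubicVertex β H a - β * ∑ p ∈ plaquettesTouching (boxEdges 4 (2 * H + 1)), tripleForm (T p) (plaqVar H p.1 p.2.1.1 p.2.1.2 a) =
        β * ∑ p ∈ plaquettesTouching (boxEdges 4 (2 * H + 1)),
          (chartPlaqCostOdd H p.1 p.2.1.1 p.2.1.2 a - tripleForm (T p) (plaqVar H p.1 p.2.1.1 p.2.1.2 a)) := by
      unfold cubicVertex
      rw [Finset.sum_sub_distrib, mul_sub]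
    rw [hV, abs_mul, abs_of_pos hβ]
    have hR : ∀ p ∈ plaquettesTouching (boxEdges 4 (2 * H + 1)),
        |chartPlaqCostOdd H p.1 p.2.1.1 p.2.1.2 a - tripleForm (T p) (plaqVar H p.1 p.2.1.1 p.2.1.2 a)| ≤ (4 + 6 * C7) * (4 * s) ^ 5 := by
      intro p _
      have h1 := abs_odd_sub_tripleForm_le (hTf _ _ (ne_of_lt p.2.2)) H p.1 p.2.1.1 p.2.1.2
        (fun t a ht ht1 hv => (h7f _ _ (ne_of_lt p.2.2) H p.1 t a ht ht1 hv).2) a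
      refine h1.trans (mul_le_mul_of_nonneg_left ?_ (by positivity))
      exact pow_le_pow_left₀ (Finset.sum_nonneg fun i _ => norm_nonneg _) (TiltSup.sum_norm_plaqVar_le hs ha p.1 p.2.1.1 p.2.1.2) 5
    have hsum := (Finset.abs_sum_le_sum_abs _ _).trans (Finset.sum_le_sum hR)
    rw [Finset.sum_const, nsmul_eq_mul] at hsum
    have hcard := TiltSup.card_plaquettesTouching_le' (H := H) hH
    have hq : 0 ≤ (4 + 6 * C7) * (4 * s) ^ 5 := by positivity
    calc β * |∑ p ∈ plaquettesTouching (boxEdges 4 (2 * H + 1)),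
            (chartPlaqCostOdd H p.1 p.2.1.1 p.2.1.2 a - tripleForm (T p) (plaqVar H p.1 p.2.1.1 p.2.1.2 a))|
        ≤ β * ((plaquettesTouching (boxEdges 4 (2 * H + 1))).card * ((4 + 6 * C7) * (4 * s) ^ 5)) :=
          mul_le_mul_of_nonneg_left hsum hβ.le
      _ ≤ β * (4096 * (H : ℝ) ^ 4 * ((4 + 6 * C7) * (4 * s) ^ 5)) :=
          mul_le_mul_of_nonneg_left (mul_le_mul_of_nonneg_right hcard hq) hβ.le
      _ = 4096 * 1024 * (4 + 6 * C7) * β * (H : ℝ) ^ 4 * s ^ 5 := by ring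
      _ ≤ max (4096 * 1024 * (4 + 6 * C7)) (max CTB 0 * C7 ^ 2) * β * (H : ℝ) ^ 4 * s ^ 5 := by
          have h0 : 0 ≤ β * (H : ℝ) ^ 4 * s ^ 5 := by positivity
          have := mul_le_mul_of_nonneg_right (le_max_left (4096 * 1024 * (4 + 6 * C7)) (max CTB 0 * C7 ^ 2)) h0
          linarith [this]
  · -- the Gaussian size of the triple-product form
    have h := hTB H hH β hβ C7 T hT
    refine h.trans ?_
    have h0 : 0 ≤ (H : ℝ) ^ 4 * (1 + Real.log H) ^ 3 / β := by
      have : 0 ≤ 1 + Real.log (H : ℝ) := by have := Real.log_nonneg hH1; linarith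
      positivity
    calc CTB * C7 ^ 2 * (H : ℝ) ^ 4 * (1 + Real.log H) ^ 3 / β = CTB * C7 ^ 2 * ((H : ℝ) ^ 4 * (1 + Real.log H) ^ 3 / β) := by ring
      _ ≤ max CTB 0 * C7 ^ 2 * ((H : ℝ) ^ 4 * (1 + Real.log H) ^ 3 / β) :=
          mul_le_mul_of_nonneg_right (mul_le_mul_of_nonneg_right (le_max_left _ _) (sq_nonneg _)) h0
      _ ≤ max (4096 * 1024 * (4 + 6 * C7)) (max CTB 0 * C7 ^ 2) * ((H : ℝ) ^ 4 * (1 + Real.log H) ^ 3 / β) :=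
          mul_le_mul_of_nonneg_right (le_max_right _ _) h0
      _ = _ := by ring

/-- ★★ **Tail of the cubic vertex on the small field**: with the constant `C` of ✓`exists_cubicVertexPoly`, for `H ≥ 1`, `β > 0`, `0 ≤ s`, `λ > 0`, `r ≥ 1`:
`E₀[1_{smallField s} · 1_{λ + C·β·H⁴·s⁵ ≤ |V₃|}] ≤ (2r−1)^{3r} · (C·H⁴·(1+log H)³/β)^r / λ^{2r}`. -/
theorem gaussAvg_sfInd_mul_indicator_cubicVertex_le : ∃ C : ℝ, 0 ≤ C ∧ ∀ H : ℕ, 1 ≤ H → ∀ β : ℝ, 0 < β → ∀ s : ℝ, 0 ≤ s →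
    ∀ lam : ℝ, 0 < lam → ∀ r : ℕ, 1 ≤ r →
      gaussAvg β H (fun a => sfInd H s a * Set.indicator {a | lam + C * β * (H : ℝ) ^ 4 * s ^ 5 ≤ |cubicVertex β H a|} (fun _ => (1 : ℝ)) a) ≤
        (2 * r - 1 : ℝ) ^ (r * 3) * (C * (H : ℝ) ^ 4 * (1 + Real.log H) ^ 3 / β) ^ r / lam ^ (2 * r) := by
  obtain ⟨C, hC, hF⟩ := exists_cubicVertexPoly
  refine ⟨C, hC, fun H hH β hβ s hs lam hlam r hr => ?_⟩
  obtain ⟨F, hFc, hFs, hFg⟩ := hF H hH β hβ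
  -- restrict the event to the small field (the factor `sfInd` kills the rest)
  set A : Set (LandauFree H → E3) := {a | lam + C * β * (H : ℝ) ^ 4 * s ^ 5 ≤ |cubicVertex β H a|} with hA
  set A' : Set (LandauFree H → E3) := {a | a ∈ smallField H s ∧ lam + C * β * (H : ℝ) ^ 4 * s ^ 5 ≤ |cubicVertex β H a|} with hA'
  have heq : (fun a => sfInd H s a * A.indicator (fun _ => (1 : ℝ)) a) = fun a => sfInd H s a * A'.indicator (fun _ => (1 : ℝ)) a := by
    funext a
    by_cases ha : a ∈ smallField H s
    · by_cases hA1 : a ∈ A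
      · have hA2 : a ∈ A' := ⟨ha, hA1⟩
        rw [Set.indicator_of_mem hA1, Set.indicator_of_mem hA2]
      · have hA2 : a ∉ A' := fun h => hA1 h.2
        rw [Set.indicator_of_notMem hA1, Set.indicator_of_notMem hA2]
    · have h0 : sfInd H s a = 0 := by rw [sfInd, Set.indicator_of_notMem ha]
      rw [h0, zero_mul, zero_mul]
  have hA'F : ∀ a ∈ A', lam ≤ |F a| := by
    intro a ha
    have h1 := hFs s hs a ha.1
    have h2 : lam + C * β * (H : ℝ) ^ 4 * s ^ 5 ≤ |cubicVertex β H a| := ha.2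
    have h3 : |cubicVertex β H a| ≤ |cubicVertex β H a - F a| + |F a| := by
      have := abs_add_le (cubicVertex β H a - F a) (F a)
      rwa [sub_add_cancel] at this
    linarith
  rw [heq]
  have h0 : 0 ≤ gaussAvg β H (fun a => F a ^ 2) := gaussAvg_nonneg H hβ fun a => sq_nonneg _
  have hr0 : (0 : ℝ) ≤ (2 * r - 1 : ℝ) ^ (r * 3) := by
    have : (1 : ℝ) ≤ 2 * r := by exact_mod_cast (show 1 ≤ 2 * r by omega)
    exact pow_nonneg (by linarith) _
  refine (gaussAvg_sfInd_mul_indicator_le_pow_of_polyCert H hβ hFc s hlam hA'F r hr).trans ?_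
  exact div_le_div_of_nonneg_right (mul_le_mul_of_nonneg_left (pow_le_pow_left₀ h0 hFg r) hr0) (by positivity)

end EdgeChartGaussian

end Summit.QuantumFields.YangMills.Theorems.AllWindowsColdBoxBoxHighLine

end
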